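import Summits.QuantumFields.YangMills.Theorems.BalabanUVNodesK0AxJoinTD9
import Summits.QuantumFields.YangMills.Theorems.BalabanUVNodesK0AxJoinTBox
import Summits.QuantumFields.YangMills.Theorems.BalabanUVNodesK0AxJoinTGeomB
import Summits.QuantumFields.YangMills.Theorems.BalabanUVNodesPortHRecordRowG

/-!
# ★ P3 g90 — LENS P3 «weaken the target», sketch №8: JOIN-T ON THE BOX OVER THE ROAD OF RECORD — the GENERIC response table `G`, its TRANSVERSE WHOLE-TORUS
# instance (D9 := `Response9DAtLocUnivξ` BY NAME), geometry (G0)–(G4) AND the leaves DISCHARGED at the record choice, and the composition with ★★★ PTB-1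
# ((Tok-cmpU-cap) discharges D9) in the (Q-ord)-correct shape ⟹ (E-lu-box); then the cofinal-radii K0ᴬ door headed by those displayed rows + (V-absmom-box).
(unit `ym-nodeO-ideate-p3` GEN 90; HOME sketch `nodeO-cover/P3-K0AxJoinTBoxLocUniv-v1.lean`; nobody's tree file; count-neutral.  Sequel to №7 ✓p818452 `…K0AxJoinTBox` (P3 g89) and to
◇ lens-1 g10 PART A ✓p818279 `…K0AxJoinTD9` — AUTHORSHIP OF THE KERNEL STEP AND OF ITS `G`-PARAMETRISATION = lens-1; of (G0)–(G4) = ✓`…K0AxJoinTGeomA ∕ GeomW ∕ GeomB`;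
of the leaves = ✓`PortHRecordRowG`; of the D9 discharge = ★★★ PTB-1 ✓`PortU8.portPieceLocalityU8_LocUniv_of_cmp`; this file only re-quantifies on BOX histories and composes BY NAME.)

LANDING NOTE (porter ▶ PTC-1 g4, 2026-08-31; AUTHORSHIP = ★ P3 g90 «weaken the target», HOME sketch `nodeO-cover/P3-K0AxJoinTBoxLocUniv-v1.lean` sha16 c9ca012253dea230 · 390 l. · 6 thm · 0 def · 0 sorry;
kernel step and its `G`-parametrisation ◇ lens-1 g9∕g10; (G0)–(G4) ✓`…K0AxJoinTGeomA ∕ GeomW ∕ GeomB` (hands geomA∕geomB, lens-1); leaves ✓`PortHRecordRowG`; D9 discharge ★★★ PTB-1): landed VERBATIM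
(only this paragraph added) on ★ P3 g90's OFFER №8 (nodeO STATUS 09:32:18Z) under the basename P3 proposed (`…K0AxJoinTBoxD9`, at ★★★ director-ym's discretion), as a helper
`--supports stmt-QuantumFields-27238 --as helper` (NO `--workitem`); ◆ CRIT-1 g36 custody∕cut + (Q-ord) `P := False` toy on :312∕:354 (HOME numbering): ◆ CUT = PASS — GO, (Q-ord) standing check
PASS ×2 by binder inspection, J1′∕J5′∕Federbush ✓, axioms standard (nodeO STATUS 2026-08-31T09:34:00Z, l.5032; ◆ also: «your `…K0AxJoinTBoxD9.lean` is fine»).  Sequel of ✓p818452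
`…K0AxJoinTBox` (№7) and ✓p818279 `…K0AxJoinTD9` (PART A).  HONEST (porter): CONDITIONAL theorems over DISPLAYED row predicates + bookkeeping by name; (E-lu-box) ∕ [E] inhabited
unconditionally NOWHERE; D1-on-the-box, the chart rows, (Tok-cmpU-cap), (V-absmom-box) all OPEN; nothing of Bałaban asserted, ported, discharged or refuted; K0ᴬ stmt-QuantumFields-27238 OPEN —
NOTHING of it proved; NODE O 0∕1; COUNT 8∕28 · K 1∕4 UNMOVED; finite 𝕋⁴ at fixed ε — NOT continuum ∕ OS ∕ Clay; the Yang–Mills mass gap is NOT proved by any of this.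

[I] = [Balaban1987RG1], [15] = [Balaban1985Variational], [II] = [Balaban1984PropagatorsII].

WHY (EDGE TABLE v2 §6; ◆ CRIT-1 g36 09:19:31Z (A) + rider (Q-ord); ★★★ №543 (1) FIX := (f2)).  The road of record for K0ᴬ's two-volume letter now runs through lens-1's GENERIC-TABLE kernel step
(`recordTwoVol_of_rows_G ∕ kstep_joinT_at_record_G`) instantiated at the transverse whole-torus table `recordGkLocWξ … Finset.univ` (`kstep_joinT_at_record_LocUniv`), whose D9 row PTB-1
discharges modulo (Tok-cmpU-cap).  Those theorems conclude [E] ALONG RUNS; the K0ᴬ–K1ᴬ junction's box rows ((L-lim-box), the Cauchy half of (C)) need (E-lu-box) (№6 v1.1 ✓p817732 :217,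
№7).  This file is the box edition OF THAT ROAD, with everything history-free discharged by name:

  ★★★ `recordTwoVol_of_rows_G_window` (§10a) — lens-1's ★★★ `recordTwoVol_of_rows_G` with the window threshold EXPOSED (`hwin` dropped; conclusion at EVERY member `m` whose inner window
      holds `z`); PROOF = lens-1's minus one `filter_upwards` (№7's `…_JC_window` is the case `G := recordGkJC`).
  ★★★ `recordPvolTwoVolExpLocUnifOnBoxAx_of_rows_box_G` (§10b) — generic table, D1 on BOX histories, every other row VERBATIM ⟹ (E-lu-box) at `(48E₀C₉²K₀′K₁ + 32E₀C₉²e^{δ₁Mg c₁}K₀′K₁, δ₁·cR)`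
      (through №7's ★ `…_of_members_box`).
  ★★★ `recordPvolTwoVolExpLocUnifOnBoxAx_of_rows_box_LocUniv` (§10c) — the same at `G k n a := recordGkLocWξ F θ k (recordK₀+n) Finset.univ a`: D9 BY NAME `Response9DAtLocUnivξ` (the box twin
      of lens-1's ★★★ `kstep_joinT_at_record_LocUniv`).
  ★★★ `recordPvolTwoVolExpLocUnifOnBoxAx_of_rows_box_LocUniv_geom` (§10d) — at the record choice `Nin := recordRNat`, `Rsep := recordR∕2 − 2Mc`, `cR := 1∕16` with (G0) ✓`rowG0`, (G1)(G2)
      ✓`rowG1∕G2_at_recordChoice` (guards `McGuard`, `Mc ≤ Mg`, `0 ≤ c₁`), (G3)(G4) ✓`eventually_window_recordRNat ∕ rateRows_recordW`, AND THE LEAVES ✓`rowCubeSumLeaf_at` (cube-sum at `δ₀∕4`,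
      constant `K₁(δ₀, Mc) = (2(1 − e^{−δ₀Mc∕4})⁻¹)⁴`) ∕ ✓`rowTreeLeaves_at` (tree at `κ∕4`, constant `B12TreeDecay.K₀ 64 8`, threshold `4·κ₀(64, 8) ≤ κ`) DISCHARGED ⟹ (E-lu-box) at rate `δ₁∕16`
      with an EXPLICIT constant in `(E₀, C₉, δ₀, κ, Mg, c₁, Mc)`.  Displayed: D1-on-the-box, the swap row, the `C²`∕zero∕link rows of the ONE chart `ιC` against the transverse table.
  ★★★ `twoVolExpBox_LocUniv_of_cmp_geom` (§10e) — ◆'s rider (Q-ord) HONOURED in shape (f2): composing §10d with ★★★ PTB-1, `(Tok-cmpU-cap) → [displayed chart rows] → ∃ C₉ δ₀, 0 ≤ C₉ ∧ 0 < δ₀ ∧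
      (E-lu-box)(A(C₉, δ₀), δ₁(δ₀)∕16)` — NO leaf constant is committed before `δ₀` is revealed (the leaves are theorems inside), so the theorem can actually be APPLIED.
      (Tok-cmpU-cap) is lens-1's tree name ✓`K0AxJoinT.TokCmpUCap F Mc a₀` (✓p818279 :323) = PTB-1's `hcmp` verbatim (accepted by δ-unfolding).
  ★   `record13SepCoPHInhabitedAx_of_cmp_chartRowsBox_pvolAbsMomentBox_cofinalRadii` (§10f) — THE COFINAL-RADII K0ᴬ DOOR OVER THE ROAD OF RECORD'S DISPLAYED ROWS: at cofinally small radii,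
      guards ∧ (V-absmom-box) ∧ (Tok-cmpU-cap) ∧ [∃ ιC: D1-on-the-box ∧ swap ∧ chart rows] ⟹ K0ᴬ BY NAME (§10e, then №7's ★★★ |β|-only box door).

WHAT REMAINS DISPLAYED, EXACTLY (nothing else): (Tok-cmpU-cap) ([II] (2.130)∕(2.148)–(2.150) — porter content); D1 = ⁸'s consequent `FormatPlusG` AT EVERY BOX HISTORY ([I] Thm 3 p.264 «for all sequences
in the box»; W1 ⟨27930⟩'s consequent as signed gives it along runs); the swap row + `C²`∕zero∕link rows of ONE chart `ιC` against `recordGkLocWξ … univ` (jointly = (ra-1)(ra-3)(ra-4) +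
`DressLink` ⟸ (C-orb), ◇ lens-1 g10 ∕ ★★ DEF-1 ed.20–21, OPEN, P0∕HypAn-level); (V-absmom-box) (finite-volume (1.22)-type moment bounds on the box, OPEN); the numeric guards.

HONEST FRAMING.  CONDITIONAL theorems over DISPLAYED row predicates + bookkeeping; NO `sorry`; nothing of Bałaban ([I] Thm 1, (1.7), (1.18)–(1.22), (4.35)–(4.37), (5.10); [15] Prop. 9;
[II] (2.130)) asserted, ported, discharged or refuted; (E-lu-box) ∕ [E] inhabited unconditionally NOWHERE; K0ᴬ stmt-QuantumFields-27238 ∕ K1ᴬ 27239 ∕ K3ᴬ 27247 OPEN; NODE O 0∕1;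
COUNT 8∕28 · K 1∕4 UNMOVED; finite `𝕋⁴_{L^K}` at fixed ε — NOT continuum ∕ ℝ⁴ ∕ OS ∕ Clay; **the Yang–Mills mass gap is NOT proved by any of this.**  No `instance`, `notation`, `private`;
standard axioms.
-/

noncomputable section

open Filter Topology
open scoped BigOperators Matrix.Norms.L2Operator

namespace Summit.QuantumFields.YangMills.Theorems.K0AxMomentRoad

open Literature.MathematicalPhysics.QuantumFieldTheory.Balaban1983to89
open Literature.MathematicalPhysics.QuantumFieldTheory.Balaban1983to89.Node00 (TermFamily1 siteOfInt polWindow polScalar betaOfRecord₁₃Ax Stage13Params)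
open Literature.MathematicalPhysics.QuantumFieldTheory.Balaban1983to89.T4Continuum (T4Family)
open Literature.MathematicalPhysics.QuantumFieldTheory.Balaban1983to89.B12FormatPlus
open Literature.MathematicalPhysics.QuantumFieldTheory.Balaban1983to89.B12Decay510 (SiteGeometry GeomLeaf CubeSumLeaf TreeLeaf KernelBound delta1 mixedDeriv)
open Summit.QuantumFields.YangMills.Theorems.K0RecordFormatNames (ΦfOf pvolOf plimOf)
open Summit.QuantumFields.YangMills.Theorems.PortH (exists_cutTo_clm pvolOf_eq_trace)
open Summit.QuantumFields.YangMills.Theorems.K0RecordFormatNames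
open Summit.QuantumFields.YangMills.Theorems.K0AxTwoVolumeRate (RecordPvolTwoVolExpOnRunsAx)
open Summit.QuantumFields.YangMills.Theorems.PortHRecordJoin (formatPlusG_chartSwap chartEquivariant_members noInvariantCovector_members chart_cut)
open Summit.QuantumFields.YangMills.Theorems.K0PortChart44DAtRecord (chart44DJ_record)
open Summit.QuantumFields.YangMills.Theorems.K0AxJoinT
open Summit.QuantumFields.YangMills.Theorems.K0AxJoinTGeomA (rowG0)
open Summit.QuantumFields.YangMills.Theorems.K0AxJoinTGeomB (rowG1_at_recordChoice rowG2_at_recordChoice)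
open Summit.QuantumFields.YangMills.Theorems.PortHRecordRowG (rowCubeSumLeaf_at rowTreeLeaves_at mc_pos)
open Literature.MathematicalPhysics.QuantumFieldTheory.Balaban1983to89.FlowStep
open Literature.MathematicalPhysics.QuantumFieldTheory.Balaban1983to89.FlowStepRuns

/-! ## §10a  The member level with a GENERIC table and the window threshold exposed (lens-1's ★★★ `recordTwoVol_of_rows_G`, re-quantified) -/

/-- ★★★ **MEMBER LEVEL, GENERIC TABLE `G`, WINDOW THRESHOLD EXPOSED** — ✓`K0AxJoinT.recordTwoVol_of_rows_G` (◇ lens-1 g10 PART A §2) VERBATIM except that the eventual-membership row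
`hwin` is dropped and the conclusion holds at EVERY member `m` whose inner window contains `z` (`∀ l, 2|z l| < Nin m`): the history `v` is ARBITRARY and enters only through ⁸'s mould
(D1 at `v`); the threshold is history-free.  Proof = lens-1's, minus one `filter_upwards`.  (№7's ★★★ `recordTwoVol_of_rows_JC_window` is the case `G := recordGkJC`.)  CONDITIONAL over
displayed rows; nothing of Bałaban asserted. [cite: Balaban1987RG1, (1.21) p.264, (1.18)–(1.19) p.263, (1.7) p.261, (4.14) p.284, (4.35)–(4.37) pp.290–291, (5.10) p.293; Balaban1985Variational, Prop. 9 p.309] -/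
theorem recordTwoVol_of_rows_G_window {E₀ κ C₉ δ₀ Mg c₁ K₀' K₁ : ℝ}
    (hE₀ : 0 ≤ E₀) (hκ : 0 < κ) (hC₉ : 0 ≤ C₉) (hδ₀ : 0 < δ₀) (hMg : 0 < Mg) (hK₀' : 0 ≤ K₀') :
    ∀ (F : T4Family) (a₀ ε₂₉ α₀ α₁ : ℝ), 0 < α₀ → 0 < α₁ → ∀ (Mc k : ℕ) (v : Fin (k + 1) → ℝ) (Nin : ℕ → ℕ) (Rsep : ℕ → ℝ),
      letI θ := thetaFill F a₀ ε₂₉; letI := θ.instVβ₁; letI := θ.instVβ₂; letI := θ.instιβ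
      ∀ (ιC : (n : ℕ) → recordW F a₀ ε₂₉ k (recordK₀ F Mc k + n) → (Fin (recordChartDimJ F (recordK₀ F Mc k + n)) → ℂ))
        (G : (n : ℕ) → θ.ιβ → RespLabel F k (recordK₀ F Mc k + n) → Fin (recordChartDimJ F (recordK₀ F Mc k + n)) → ℂ),
      B12FormatPlus.FormatPlusG (fun n => recordDomSys F Mc k (recordK₀ F Mc k + n)) (fun n => recordBondCount F (recordK₀ F Mc k + n))
          (fun n => recordAct F (recordK₀ F Mc k + n)) (fun n => recordUc F Mc k α₀ α₁ (recordK₀ F Mc k + n))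
          (fun n => recordCoords F Mc k (recordK₀ F Mc k + n)) (fun n => recordChartDimJ F (recordK₀ F Mc k + n))
          (fun n => recordChartJ F Mc k (recordK₀ F Mc k + n)) (fun n => recordΦfAx F a₀ ε₂₉ k v (recordK₀ F Mc k + n))
          (fun n => recordEmbJ F θ k (recordK₀ F Mc k + n)) (fun n => recordWrapCtr F Mc k (recordK₀ F Mc k + n))
          (fun n => recordDomEmbCtr F Mc k (recordK₀ F Mc k + n)) (fun n _ => recordCoordProjCtr F (recordK₀ F Mc k + n)) E₀ κ →
      (∀ n : ℕ, ∀ᶠ B in 𝓝 (0 : recordW F a₀ ε₂₉ k (recordK₀ F Mc k + n)), ∀ X : (recordDomSys F Mc k (recordK₀ F Mc k + n)).Dom,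
          ∃ g : recordGaugeGrp F (recordK₀ F Mc k + n), ∀ i ∈ recordCoords F Mc k (recordK₀ F Mc k + n) X,
            recordChartJ F Mc k (recordK₀ F Mc k + n) X (ιC n B) i =
              recordAct F (recordK₀ F Mc k + n) g (recordChartJ F Mc k (recordK₀ F Mc k + n) X (recordEmbJ F θ k (recordK₀ F Mc k + n) B)) i) →
      (∀ a : θ.ιβ, Response9D (dataG F Mc k (recordK₀ F Mc k) (fun n => G n a)) (fun n => recordChartJ F Mc k (recordK₀ F Mc k + n))
          (fun n => recordRNat F Mc k (recordK₀ F Mc k + n)) (fun n X => recordDom44J F Mc k (recordK₀ F Mc k + n) X (min (1 / 4 : ℝ) (min α₁ (α₀ / 36)))) C₉ δ₀) →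
      (∀ n : ℕ, ContDiffAt ℝ 2 (ιC n) 0 ∧ ιC n 0 = 0) →
      (∀ (n : ℕ) (a : θ.ιβ) (l : RespLabel F k (recordK₀ F Mc k + n)),
          G n a l = fun i => fderiv ℝ (ιC n) 0 (Pi.single l.1 (Pi.single l.2 (θ.bV a))) i) →
      (∀ n : ℕ, Set.InjOn (recordDomEmbCtr F Mc k (recordK₀ F Mc k + n)) {X | X ∉ recordWrapCtr F Mc k (recordK₀ F Mc k + n)}) →
      (∀ (n : ℕ) (X : (recordDomSys F Mc k (recordK₀ F Mc k + n)).Dom), X ∈ recordWrapCtr F Mc k (recordK₀ F Mc k + n) →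
          ∀ (μ : Fin 4) (z : Fin 4 → ℤ), (∀ l, 2 * |z l| < (Nin n : ℤ)) →
            Rsep n ≤ (recordSiteGeom F Mc k (recordK₀ F Mc k + n)).distD (recordE F k (recordK₀ F Mc k + n) μ z) X +
              Mg * ((recordDomSys F Mc k (recordK₀ F Mc k + n)).dj X + c₁)) →
      (∀ (n : ℕ) (X' : (recordDomSys F Mc k (recordK₀ F Mc k + (n + 1))).Dom),
          (∀ X, X ∉ recordWrapCtr F Mc k (recordK₀ F Mc k + n) → recordDomEmbCtr F Mc k (recordK₀ F Mc k + n) X ≠ X') →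
          ∀ (μ : Fin 4) (z : Fin 4 → ℤ), (∀ l, 2 * |z l| < (Nin n : ℤ)) →
            Rsep n ≤
              (recordSiteGeom F Mc k (recordK₀ F Mc k + (n + 1))).distD (recordE F k (recordK₀ F Mc k + (n + 1)) μ z) X' +
                Mg * ((recordDomSys F Mc k (recordK₀ F Mc k + (n + 1))).dj X' + c₁)) →
      (∀ n : ℕ, Nin n ≤ recordRNat F Mc k (recordK₀ F Mc k + n)) →
      (∀ n : ℕ, B12Decay510.CubeSumLeaf (recordSiteGeom F Mc k (recordK₀ F Mc k + n)) (δ₀ / 4) K₁ ∧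
          B12Decay510.TreeLeaf (recordCc F Mc k (recordK₀ F Mc k + n)) (κ / 4) K₀') →
      ∀ (μ ν : Fin 4) (z : Fin 4 → ℤ) (m : ℕ), (∀ l, 2 * |z l| < (Nin m : ℤ)) →
        |recordPvolAx F a₀ ε₂₉ k v (recordK₀ F Mc k + (m + 1)) μ ν z - recordPvolAx F a₀ ε₂₉ k v (recordK₀ F Mc k + m) μ ν z| ≤
          48 * E₀ * C₉ ^ 2 * K₀' * K₁ * Real.exp (-δ₀ * (recordRNat F Mc k (recordK₀ F Mc k + m) : ℝ) / 2) +
            32 * E₀ * C₉ ^ 2 * Real.exp (B12Decay510.delta1 δ₀ κ Mg * Mg * c₁) * K₀' * K₁ *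
              Real.exp (-(B12Decay510.delta1 δ₀ κ Mg) * Rsep m) := by
  classical
  intro F a₀ ε₂₉ α₀ α₁ hα₀ hα₁ Mc k v Nin Rsep ιC G hFmt hsw hResp hreg hGk hinj hsepW hsepF hNin hleaf μ ν z m hm
  letI θ := thetaFill F a₀ ε₂₉; letI := θ.instVβ₁; letI := θ.instVβ₂; letI := θ.instιβ
  have hFmtC := formatPlusG_chartSwap hFmt hsw
  have hnegW : ∀ (n : ℕ) (z : Fin 4 → ℤ), (∀ l, 2 * |z l| < (Nin n : ℤ)) → ∀ l, 2 * |(-z) l| < (Nin n : ℤ) := fun n z hz l => by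
    simpa only [Pi.neg_apply, abs_neg] using hz l
  refine twoVol_pvolOf_of_rows_trace F (recordTermsAx F a₀ ε₂₉) θ.ρ8 θ.bV k v
    (fun n => recordUc F Mc k α₀ α₁ (recordK₀ F Mc k + n)) (fun n => recordCoords F Mc k (recordK₀ F Mc k + n))
    (fun n => recordChartJ F Mc k (recordK₀ F Mc k + n))
    (fun n X => recordDom44J F Mc k (recordK₀ F Mc k + n) X (min (1 / 4 : ℝ) (min α₁ (α₀ / 36))))
    (fun n => recordAct F (recordK₀ F Mc k + n)) (fun n => recordToG F (recordK₀ F Mc k + n)) (fun n => recordAdJ F (recordK₀ F Mc k + n))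
    (flipG F Mc k (recordK₀ F Mc k) (fun n => G n (recordAStar F a₀ ε₂₉))) (fun n => recordK₀ F Mc k + n)
    (fun n a (y : RespLabel F k (recordK₀ F Mc k + n)) => G n a y) ιC
    (N := fun n => recordRNat F Mc k (recordK₀ F Mc k + n)) (Nin := Nin) (Rsep := Rsep) (K₁ := K₁)
    hE₀ hκ.le hC₉ hδ₀.le hMg hK₀' hFmtC (chart44DJ_record F Mc k hα₀ hα₁)
    (chartEquivariant_members Mc k (recordK₀ F Mc k)) (noInvariantCovector_members (recordK₀ F Mc k))
    (chart_cut_members_G F Mc k (recordK₀ F Mc k) (fun n => G n (recordAStar F a₀ ε₂₉)) _)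
    ?_ ?_ ?_ ?_ hinj hNin ?_ ?_ (fun n => (hleaf n).1) (fun n => (hleaf n).2) ?_ m μ ν z hm
  · exact fun n a X y => (response9D_flipG F Mc k (recordK₀ F Mc k) (fun n => G n a) (hResp a)).2.2.1 n X y
  · exact (response9D_flipG F Mc k (recordK₀ F Mc k) (fun n => G n (recordAStar F a₀ ε₂₉)) (hResp _)).2.2.2.1
  · exact fun n a X hX μ' z' hz' => (response9D_flipG F Mc k (recordK₀ F Mc k) (fun n => G n a) (hResp a)).2.2.2.2.1 n X hX μ' z' hz'
  · exact (response9D_flipG F Mc k (recordK₀ F Mc k) (fun n => G n (recordAStar F a₀ ε₂₉)) (hResp _)).2.2.2.2.2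
  · intro n X hX μ' z' hz'
    rw [flipG_e]
    exact hsepW n X hX μ' (-z') (hnegW n z' hz')
  · intro n X' hX' μ' z' hz'
    rw [flipG_e]
    exact hsepF n X' hX' μ' (-z') (hnegW n z' hz')
  · exact fun n => ⟨(hreg n).2, (hreg n).1, fun a μ' z' => hGk n a _⟩

/-! ## §10b  Generic table, D1 on the box ⟹ (E-lu-box) -/

/-- ★★★ **`kstep` ON THE BOX, GENERIC TABLE `G`** — ✓`K0AxJoinT.kstep_joinT_at_record_G` (◇ lens-1 g10) with ⁸'s mould D1 supplied at EVERY BOX HISTORY `v ∈ Box γ₀ k`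
(`FormatPlusG … (recordΦfAx F a₀ ε₂₉ k v (recordK₀+n)) …`) instead of along `]0, γ₀]`-runs; the swap row, per `k` a «Prop. 9» receipt for `dataG … (G k · a)` ∧ `C²`∕zero ∧ link
`G k n a l = Dι_C(0)[δ_l ⊗ bV a]`, (G0)–(G4), leaves VERBATIM ⟹ **(E-lu-box)** `RecordPvolTwoVolExpLocUnifOnBoxAx F a₀ ε₂₉ γ₀ (48E₀C₉²K₀′K₁ + 32E₀C₉²e^{δ₁Mg c₁}K₀′K₁) (δ₁·cR)`,
`δ₁ = delta1 δ₀ κ Mg` (№7's ★★★ `…_of_rows_box` is the case `G := recordGkJC`).  CONDITIONAL: every displayed row is a hypothesis; (E-lu-box) inhabited unconditionally NOWHERE;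
nothing of Bałaban asserted; K0ᴬ 27238 OPEN; the Yang–Mills mass gap is NOT proved.
[cite: Balaban1987RG1, Thm 1 p.259, Thm 3 p.264, (0.20) p.256, (1.7) p.261, (1.18)–(1.22) pp.263–264, (4.4)–(4.5) pp.281–282, (4.14) p.284, (4.35)–(4.37) pp.290–291; Balaban1985Variational, Prop. 9 p.309] -/
theorem recordPvolTwoVolExpLocUnifOnBoxAx_of_rows_box_G {E₀ κ C₉ δ₀ Mg c₁ K₀' K₁ : ℝ}
    (hE₀ : 0 ≤ E₀) (hκ : 0 < κ) (hC₉ : 0 ≤ C₉) (hδ₀ : 0 < δ₀) (hMg : 0 < Mg) (hK₀' : 0 ≤ K₀') :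
    ∀ (F : T4Family) (a₀ ε₂₉ γ₀ α₀ α₁ : ℝ), 0 < α₀ → 0 < α₁ → ∀ (Mc : ℕ) (Nin : ℕ → ℕ → ℕ) (Rsep : ℕ → ℕ → ℝ) (cR : ℝ), 0 < cR → cR ≤ 1 / 4 →
      letI θ := thetaFill F a₀ ε₂₉; letI := θ.instVβ₁; letI := θ.instVβ₂; letI := θ.instιβ
      ∀ (ιC : (k n : ℕ) → recordW F a₀ ε₂₉ k (recordK₀ F Mc k + n) → (Fin (recordChartDimJ F (recordK₀ F Mc k + n)) → ℂ))
        (G : (k n : ℕ) → θ.ιβ → RespLabel F k (recordK₀ F Mc k + n) → Fin (recordChartDimJ F (recordK₀ F Mc k + n)) → ℂ),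
      (∀ (k : ℕ) (v : Fin (k + 1) → ℝ), v ∈ FlowStep.Box γ₀ k →
        B12FormatPlus.FormatPlusG (fun n => recordDomSys F Mc k (recordK₀ F Mc k + n)) (fun n => recordBondCount F (recordK₀ F Mc k + n))
          (fun n => recordAct F (recordK₀ F Mc k + n)) (fun n => recordUc F Mc k α₀ α₁ (recordK₀ F Mc k + n))
          (fun n => recordCoords F Mc k (recordK₀ F Mc k + n)) (fun n => recordChartDimJ F (recordK₀ F Mc k + n))
          (fun n => recordChartJ F Mc k (recordK₀ F Mc k + n)) (fun n => recordΦfAx F a₀ ε₂₉ k v (recordK₀ F Mc k + n))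
          (fun n => recordEmbJ F θ k (recordK₀ F Mc k + n)) (fun n => recordWrapCtr F Mc k (recordK₀ F Mc k + n))
          (fun n => recordDomEmbCtr F Mc k (recordK₀ F Mc k + n)) (fun n _ => recordCoordProjCtr F (recordK₀ F Mc k + n)) E₀ κ) →
      (∀ (k n : ℕ), ∀ᶠ B in 𝓝 (0 : recordW F a₀ ε₂₉ k (recordK₀ F Mc k + n)), ∀ X : (recordDomSys F Mc k (recordK₀ F Mc k + n)).Dom,
          ∃ g : recordGaugeGrp F (recordK₀ F Mc k + n), ∀ i ∈ recordCoords F Mc k (recordK₀ F Mc k + n) X,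
            recordChartJ F Mc k (recordK₀ F Mc k + n) X (ιC k n B) i =
              recordAct F (recordK₀ F Mc k + n) g (recordChartJ F Mc k (recordK₀ F Mc k + n) X (recordEmbJ F θ k (recordK₀ F Mc k + n) B)) i) →
      (∀ k : ℕ, (∀ a : θ.ιβ, Response9D (dataG F Mc k (recordK₀ F Mc k) (fun n => G k n a)) (fun n => recordChartJ F Mc k (recordK₀ F Mc k + n))
            (fun n => recordRNat F Mc k (recordK₀ F Mc k + n)) (fun n X => recordDom44J F Mc k (recordK₀ F Mc k + n) X (min (1 / 4 : ℝ) (min α₁ (α₀ / 36)))) C₉ δ₀) ∧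
          (∀ n : ℕ, ContDiffAt ℝ 2 (ιC k n) 0 ∧ ιC k n 0 = 0) ∧
          ∀ (n : ℕ) (a : θ.ιβ) (l : RespLabel F k (recordK₀ F Mc k + n)),
            G k n a l = fun i => fderiv ℝ (ιC k n) 0 (Pi.single l.1 (Pi.single l.2 (θ.bV a))) i) →
      (∀ k n : ℕ, Set.InjOn (recordDomEmbCtr F Mc k (recordK₀ F Mc k + n)) {X | X ∉ recordWrapCtr F Mc k (recordK₀ F Mc k + n)}) →
      (∀ (k n : ℕ) (X : (recordDomSys F Mc k (recordK₀ F Mc k + n)).Dom), X ∈ recordWrapCtr F Mc k (recordK₀ F Mc k + n) →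
          ∀ (μ : Fin 4) (z : Fin 4 → ℤ), (∀ l, 2 * |z l| < (Nin k n : ℤ)) →
            Rsep k n ≤ (recordSiteGeom F Mc k (recordK₀ F Mc k + n)).distD (recordE F k (recordK₀ F Mc k + n) μ z) X +
              Mg * ((recordDomSys F Mc k (recordK₀ F Mc k + n)).dj X + c₁)) →
      (∀ (k n : ℕ) (X' : (recordDomSys F Mc k (recordK₀ F Mc k + (n + 1))).Dom),
          (∀ X, X ∉ recordWrapCtr F Mc k (recordK₀ F Mc k + n) → recordDomEmbCtr F Mc k (recordK₀ F Mc k + n) X ≠ X') →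
          ∀ (μ : Fin 4) (z : Fin 4 → ℤ), (∀ l, 2 * |z l| < (Nin k n : ℤ)) →
            Rsep k n ≤
              (recordSiteGeom F Mc k (recordK₀ F Mc k + (n + 1))).distD (recordE F k (recordK₀ F Mc k + (n + 1)) μ z) X' +
                Mg * ((recordDomSys F Mc k (recordK₀ F Mc k + (n + 1))).dj X' + c₁)) →
      (∀ k n : ℕ, Nin k n ≤ recordRNat F Mc k (recordK₀ F Mc k + n)) → (∀ (k : ℕ) (z : Fin 4 → ℤ), ∀ᶠ n in atTop, ∀ l, 2 * |z l| < (Nin k n : ℤ)) →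
      (∀ k n : ℕ, cR * (recordN F k (recordK₀ F Mc k + n) : ℝ) ≤ Rsep k n ∧
          (recordN F k (recordK₀ F Mc k + n) : ℝ) / 4 ≤ (recordRNat F Mc k (recordK₀ F Mc k + n) : ℝ)) →
      (∀ k n : ℕ, B12Decay510.CubeSumLeaf (recordSiteGeom F Mc k (recordK₀ F Mc k + n)) (δ₀ / 4) K₁ ∧
          B12Decay510.TreeLeaf (recordCc F Mc k (recordK₀ F Mc k + n)) (κ / 4) K₀') →
      RecordPvolTwoVolExpLocUnifOnBoxAx F a₀ ε₂₉ γ₀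
        (48 * E₀ * C₉ ^ 2 * K₀' * K₁ + 32 * E₀ * C₉ ^ 2 * Real.exp (B12Decay510.delta1 δ₀ κ Mg * Mg * c₁) * K₀' * K₁) (B12Decay510.delta1 δ₀ κ Mg * cR) := by
  intro F a₀ ε₂₉ γ₀ α₀ α₁ hα₀ hα₁ Mc Nin Rsep cR hcR hcR4 ιC G h8 hsw h9 hinj hsepW hsepF hNin hwin hNR hleaf
  have hK₁ : 0 ≤ K₁ :=
    (Finset.sum_nonneg fun c _ => (Real.exp_pos _).le).trans ((hleaf 0 0).1 (recordE F 0 (recordK₀ F Mc 0 + 0) 0 0))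
  have hA : 0 ≤ 48 * E₀ * C₉ ^ 2 * K₀' * K₁ := by positivity
  have hB : 0 ≤ 32 * E₀ * C₉ ^ 2 * Real.exp (B12Decay510.delta1 δ₀ κ Mg * Mg * c₁) * K₀' * K₁ := by positivity
  exact recordPvolTwoVolExpLocUnifOnBoxAx_of_members_box F a₀ ε₂₉ γ₀ Mc Nin Rsep hA hB (B12Decay510.delta1_pos hδ₀ hκ hMg)
    (B12Decay510.delta1_le_half δ₀ κ Mg) hcR hcR4 hNR hwin fun k v hv μ ν z m hm =>
      recordTwoVol_of_rows_G_window hE₀ hκ hC₉ hδ₀ hMg hK₀' F a₀ ε₂₉ α₀ α₁ hα₀ hα₁ Mc k v (Nin k) (Rsep k) (ιC k) (G k)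
        (h8 k v hv) (hsw k) (h9 k).1 (h9 k).2.1 (h9 k).2.2 (hinj k) (hsepW k) (hsepF k) (hNin k) (hleaf k) μ ν z m hm

/-! ## §10c  The box edition with D9 := the TRANSVERSE WHOLE-TORUS receipt `Response9DAtLocUnivξ` (BY NAME) -/

/-- ★★★ **`kstep` ON THE BOX, D9-XFER EDITION** — §10b at the transverse whole-torus table `G k n a := recordGkLocWξ F θ k (recordK₀ F Mc k + n) Finset.univ a` (★ LocC): the D9
row is, BY NAME, ★ LocE's `∀ a, Response9DAtLocUnivξ F θ a Mc k (recordK₀ F Mc k) (min ¼ (min α₁ (α₀∕36))) C₉ δ₀` — INHABITED under (Tok-cmpU-cap) by ★★★ PTB-1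
✓`PortU8.portPieceLocalityU8_LocUniv_of_cmp` (§10e composes) — and the link row ties the ONE chart `ιC` (swap row displayed) to THAT table; the box twin of lens-1's ★★★
`kstep_joinT_at_record_LocUniv`.  CONDITIONAL: every displayed row is a hypothesis; nothing of Bałaban asserted; K0ᴬ 27238 OPEN; the Yang–Mills mass gap is NOT proved.
[cite: Balaban1987RG1, Thm 1 p.259, Thm 3 p.264, (1.7) p.261, (1.18)–(1.22) pp.263–264, (4.4)–(4.5) pp.281–282, (4.35)–(4.37) pp.290–291; Balaban1985Variational, Prop. 9 p.309, (190) p.308; Balaban1984PropagatorsII, (2.35) p.228] -/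
theorem recordPvolTwoVolExpLocUnifOnBoxAx_of_rows_box_LocUniv {E₀ κ C₉ δ₀ Mg c₁ K₀' K₁ : ℝ}
    (hE₀ : 0 ≤ E₀) (hκ : 0 < κ) (hC₉ : 0 ≤ C₉) (hδ₀ : 0 < δ₀) (hMg : 0 < Mg) (hK₀' : 0 ≤ K₀') :
    ∀ (F : T4Family) (a₀ ε₂₉ γ₀ α₀ α₁ : ℝ), 0 < α₀ → 0 < α₁ → ∀ (Mc : ℕ) (Nin : ℕ → ℕ → ℕ) (Rsep : ℕ → ℕ → ℝ) (cR : ℝ), 0 < cR → cR ≤ 1 / 4 →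
      letI θ := thetaFill F a₀ ε₂₉; letI := θ.instVβ₁; letI := θ.instVβ₂; letI := θ.instιβ
      ∀ ιC : (k n : ℕ) → recordW F a₀ ε₂₉ k (recordK₀ F Mc k + n) → (Fin (recordChartDimJ F (recordK₀ F Mc k + n)) → ℂ),
      (∀ (k : ℕ) (v : Fin (k + 1) → ℝ), v ∈ FlowStep.Box γ₀ k →
        B12FormatPlus.FormatPlusG (fun n => recordDomSys F Mc k (recordK₀ F Mc k + n)) (fun n => recordBondCount F (recordK₀ F Mc k + n))
          (fun n => recordAct F (recordK₀ F Mc k + n)) (fun n => recordUc F Mc k α₀ α₁ (recordK₀ F Mc k + n))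
          (fun n => recordCoords F Mc k (recordK₀ F Mc k + n)) (fun n => recordChartDimJ F (recordK₀ F Mc k + n))
          (fun n => recordChartJ F Mc k (recordK₀ F Mc k + n)) (fun n => recordΦfAx F a₀ ε₂₉ k v (recordK₀ F Mc k + n))
          (fun n => recordEmbJ F θ k (recordK₀ F Mc k + n)) (fun n => recordWrapCtr F Mc k (recordK₀ F Mc k + n))
          (fun n => recordDomEmbCtr F Mc k (recordK₀ F Mc k + n)) (fun n _ => recordCoordProjCtr F (recordK₀ F Mc k + n)) E₀ κ) →
      (∀ (k n : ℕ), ∀ᶠ B in 𝓝 (0 : recordW F a₀ ε₂₉ k (recordK₀ F Mc k + n)), ∀ X : (recordDomSys F Mc k (recordK₀ F Mc k + n)).Dom,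
          ∃ g : recordGaugeGrp F (recordK₀ F Mc k + n), ∀ i ∈ recordCoords F Mc k (recordK₀ F Mc k + n) X,
            recordChartJ F Mc k (recordK₀ F Mc k + n) X (ιC k n B) i =
              recordAct F (recordK₀ F Mc k + n) g (recordChartJ F Mc k (recordK₀ F Mc k + n) X (recordEmbJ F θ k (recordK₀ F Mc k + n) B)) i) →
      (∀ k : ℕ, (∀ a : θ.ιβ, Response9DAtLocUnivξ F θ a Mc k (recordK₀ F Mc k) (min (1 / 4 : ℝ) (min α₁ (α₀ / 36))) C₉ δ₀) ∧
          (∀ n : ℕ, ContDiffAt ℝ 2 (ιC k n) 0 ∧ ιC k n 0 = 0) ∧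
          ∀ (n : ℕ) (a : θ.ιβ) (l : RespLabel F k (recordK₀ F Mc k + n)),
            recordGkLocWξ F θ k (recordK₀ F Mc k + n) Finset.univ a l = fun i => fderiv ℝ (ιC k n) 0 (Pi.single l.1 (Pi.single l.2 (θ.bV a))) i) →
      (∀ k n : ℕ, Set.InjOn (recordDomEmbCtr F Mc k (recordK₀ F Mc k + n)) {X | X ∉ recordWrapCtr F Mc k (recordK₀ F Mc k + n)}) →
      (∀ (k n : ℕ) (X : (recordDomSys F Mc k (recordK₀ F Mc k + n)).Dom), X ∈ recordWrapCtr F Mc k (recordK₀ F Mc k + n) →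
          ∀ (μ : Fin 4) (z : Fin 4 → ℤ), (∀ l, 2 * |z l| < (Nin k n : ℤ)) →
            Rsep k n ≤ (recordSiteGeom F Mc k (recordK₀ F Mc k + n)).distD (recordE F k (recordK₀ F Mc k + n) μ z) X +
              Mg * ((recordDomSys F Mc k (recordK₀ F Mc k + n)).dj X + c₁)) →
      (∀ (k n : ℕ) (X' : (recordDomSys F Mc k (recordK₀ F Mc k + (n + 1))).Dom),
          (∀ X, X ∉ recordWrapCtr F Mc k (recordK₀ F Mc k + n) → recordDomEmbCtr F Mc k (recordK₀ F Mc k + n) X ≠ X') →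
          ∀ (μ : Fin 4) (z : Fin 4 → ℤ), (∀ l, 2 * |z l| < (Nin k n : ℤ)) →
            Rsep k n ≤
              (recordSiteGeom F Mc k (recordK₀ F Mc k + (n + 1))).distD (recordE F k (recordK₀ F Mc k + (n + 1)) μ z) X' +
                Mg * ((recordDomSys F Mc k (recordK₀ F Mc k + (n + 1))).dj X' + c₁)) →
      (∀ k n : ℕ, Nin k n ≤ recordRNat F Mc k (recordK₀ F Mc k + n)) → (∀ (k : ℕ) (z : Fin 4 → ℤ), ∀ᶠ n in atTop, ∀ l, 2 * |z l| < (Nin k n : ℤ)) →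
      (∀ k n : ℕ, cR * (recordN F k (recordK₀ F Mc k + n) : ℝ) ≤ Rsep k n ∧
          (recordN F k (recordK₀ F Mc k + n) : ℝ) / 4 ≤ (recordRNat F Mc k (recordK₀ F Mc k + n) : ℝ)) →
      (∀ k n : ℕ, B12Decay510.CubeSumLeaf (recordSiteGeom F Mc k (recordK₀ F Mc k + n)) (δ₀ / 4) K₁ ∧
          B12Decay510.TreeLeaf (recordCc F Mc k (recordK₀ F Mc k + n)) (κ / 4) K₀') →
      RecordPvolTwoVolExpLocUnifOnBoxAx F a₀ ε₂₉ γ₀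
        (48 * E₀ * C₉ ^ 2 * K₀' * K₁ + 32 * E₀ * C₉ ^ 2 * Real.exp (B12Decay510.delta1 δ₀ κ Mg * Mg * c₁) * K₀' * K₁) (B12Decay510.delta1 δ₀ κ Mg * cR) := by
  intro F a₀ ε₂₉ γ₀ α₀ α₁ hα₀ hα₁ Mc Nin Rsep cR hcR hcR4 ιC h8 hsw h9
  exact recordPvolTwoVolExpLocUnifOnBoxAx_of_rows_box_G hE₀ hκ hC₉ hδ₀ hMg hK₀' F a₀ ε₂₉ γ₀ α₀ α₁ hα₀ hα₁ Mc Nin Rsep cR hcR hcR4 ιC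
    (fun k n a => recordGkLocWξ F (thetaFill F a₀ ε₂₉) k (recordK₀ F Mc k + n) Finset.univ a) h8 hsw
    (fun k => ⟨fun a => (h9 k).1 a, (h9 k).2.1, (h9 k).2.2⟩)

/-! ## §10d  At the record choice: (G0)–(G4) AND the leaves discharged by name -/

/-- ★★★ **`kstep` ON THE BOX, D9-XFER EDITION, GEOMETRY AND LEAVES DISCHARGED** — §10c at the record choice `Nin k n := recordRNat F Mc k (recordK₀+n)`,
`Rsep k n := recordR F Mc k (recordK₀+n) ∕ 2 − 2Mc`, `cR := 1∕16` (◆ CRIT-1 g36 (D), ★★★ №535) with (G0) ✓`K0AxJoinTGeomA.rowG0`, (G1)(G2) ✓`K0AxJoinTGeomB.rowG1∕rowG2_at_recordChoice`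
(guards `McGuard F Mc`, `Mc ≤ Mg`, `0 ≤ c₁`), (G3)(G4) ✓`eventually_window_recordRNat ∕ rateRows_recordW`, the cube-sum leaf ✓`PortHRecordRowG.rowCubeSumLeaf_at` at `δ₀∕4` (constant
`(2(1 − e^{−(δ₀∕4)·Mc})⁻¹)⁴`) and the tree leaf ✓`PortHRecordRowG.rowTreeLeaves_at` at `κ∕4 = κ∕2∕2` (constant `B12TreeDecay.K₀ (4·2⁴) (2·4)`, threshold `4·κ₀(4·2⁴, 2·4) ≤ κ`) ALL SUPPLIED
⟹ **(E-lu-box) at rate `δ₁∕16` with an explicit constant**.  Displayed, verbatim: D1 on the box, the swap row, the D9-LocUniv ∧ `C²`∕zero ∧ link rows.  CONDITIONAL; nothing of Bałaban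
asserted; K0ᴬ 27238 OPEN; the Yang–Mills mass gap is NOT proved.
[cite: Balaban1987RG1, Thm 1 p.259, Thm 3 p.264, §0 p.257, (0.20) p.256, (0.26) pp.257–258, (1.7) p.261, (1.18)–(1.22) pp.263–264, (4.4)–(4.5) pp.281–282, (4.35)–(4.37) pp.290–291, (5.10) p.293; Balaban1985Variational, Prop. 9 p.309, (190) p.308] -/
theorem recordPvolTwoVolExpLocUnifOnBoxAx_of_rows_box_LocUniv_geom {E₀ κ C₉ δ₀ Mg c₁ : ℝ}
    (hE₀ : 0 ≤ E₀) (hκ : 0 < κ) (hκ₀ : 4 * B12TreeDecay.kappa₀ (4 * 2 ^ 4) (2 * 4) ≤ κ) (hC₉ : 0 ≤ C₉) (hδ₀ : 0 < δ₀) (hc₁ : 0 ≤ c₁) :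
    ∀ (F : T4Family) (a₀ ε₂₉ γ₀ α₀ α₁ : ℝ), 0 < α₀ → 0 < α₁ → ∀ (Mc : ℕ), McGuard F Mc → (Mc : ℝ) ≤ Mg →
      letI θ := thetaFill F a₀ ε₂₉; letI := θ.instVβ₁; letI := θ.instVβ₂; letI := θ.instιβ
      ∀ ιC : (k n : ℕ) → recordW F a₀ ε₂₉ k (recordK₀ F Mc k + n) → (Fin (recordChartDimJ F (recordK₀ F Mc k + n)) → ℂ),
      (∀ (k : ℕ) (v : Fin (k + 1) → ℝ), v ∈ FlowStep.Box γ₀ k →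
        B12FormatPlus.FormatPlusG (fun n => recordDomSys F Mc k (recordK₀ F Mc k + n)) (fun n => recordBondCount F (recordK₀ F Mc k + n))
          (fun n => recordAct F (recordK₀ F Mc k + n)) (fun n => recordUc F Mc k α₀ α₁ (recordK₀ F Mc k + n))
          (fun n => recordCoords F Mc k (recordK₀ F Mc k + n)) (fun n => recordChartDimJ F (recordK₀ F Mc k + n))
          (fun n => recordChartJ F Mc k (recordK₀ F Mc k + n)) (fun n => recordΦfAx F a₀ ε₂₉ k v (recordK₀ F Mc k + n))
          (fun n => recordEmbJ F θ k (recordK₀ F Mc k + n)) (fun n => recordWrapCtr F Mc k (recordK₀ F Mc k + n))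
          (fun n => recordDomEmbCtr F Mc k (recordK₀ F Mc k + n)) (fun n _ => recordCoordProjCtr F (recordK₀ F Mc k + n)) E₀ κ) →
      (∀ (k n : ℕ), ∀ᶠ B in 𝓝 (0 : recordW F a₀ ε₂₉ k (recordK₀ F Mc k + n)), ∀ X : (recordDomSys F Mc k (recordK₀ F Mc k + n)).Dom,
          ∃ g : recordGaugeGrp F (recordK₀ F Mc k + n), ∀ i ∈ recordCoords F Mc k (recordK₀ F Mc k + n) X,
            recordChartJ F Mc k (recordK₀ F Mc k + n) X (ιC k n B) i =
              recordAct F (recordK₀ F Mc k + n) g (recordChartJ F Mc k (recordK₀ F Mc k + n) X (recordEmbJ F θ k (recordK₀ F Mc k + n) B)) i) →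
      (∀ k : ℕ, (∀ a : θ.ιβ, Response9DAtLocUnivξ F θ a Mc k (recordK₀ F Mc k) (min (1 / 4 : ℝ) (min α₁ (α₀ / 36))) C₉ δ₀) ∧
          (∀ n : ℕ, ContDiffAt ℝ 2 (ιC k n) 0 ∧ ιC k n 0 = 0) ∧
          ∀ (n : ℕ) (a : θ.ιβ) (l : RespLabel F k (recordK₀ F Mc k + n)),
            recordGkLocWξ F θ k (recordK₀ F Mc k + n) Finset.univ a l = fun i => fderiv ℝ (ιC k n) 0 (Pi.single l.1 (Pi.single l.2 (θ.bV a))) i) →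
      RecordPvolTwoVolExpLocUnifOnBoxAx F a₀ ε₂₉ γ₀
        (48 * E₀ * C₉ ^ 2 * B12TreeDecay.K₀ (4 * 2 ^ 4) (2 * 4) * (2 * (1 - Real.exp (-(δ₀ / 4 * (Mc : ℝ))))⁻¹) ^ 4 +
          32 * E₀ * C₉ ^ 2 * Real.exp (B12Decay510.delta1 δ₀ κ Mg * Mg * c₁) * B12TreeDecay.K₀ (4 * 2 ^ 4) (2 * 4) *
            (2 * (1 - Real.exp (-(δ₀ / 4 * (Mc : ℝ))))⁻¹) ^ 4)
        (B12Decay510.delta1 δ₀ κ Mg * (1 / 16)) := by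
  intro F a₀ ε₂₉ γ₀ α₀ α₁ hα₀ hα₁ Mc hMc hMgMc ιC h8 hsw h9
  have hMc0 : (0 : ℝ) < Mc := by exact_mod_cast mc_pos hMc
  have hMg : 0 < Mg := lt_of_lt_of_le hMc0 hMgMc
  have hquart : κ / 2 / 2 = κ / 4 := by ring
  have hleaf : ∀ k n : ℕ, B12Decay510.CubeSumLeaf (recordSiteGeom F Mc k (recordK₀ F Mc k + n)) (δ₀ / 4) ((2 * (1 - Real.exp (-(δ₀ / 4 * (Mc : ℝ))))⁻¹) ^ 4) ∧
      B12Decay510.TreeLeaf (recordCc F Mc k (recordK₀ F Mc k + n)) (κ / 4) (B12TreeDecay.K₀ (4 * 2 ^ 4) (2 * 4)) := fun k n =>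
    ⟨rowCubeSumLeaf_at (a := δ₀ / 4) hMc k (recordK₀ F Mc k + n) (div_pos hδ₀ (by norm_num)),
      hquart ▸ (rowTreeLeaves_at F hκ₀ Mc k (recordK₀ F Mc k + n)).2⟩
  exact recordPvolTwoVolExpLocUnifOnBoxAx_of_rows_box_LocUniv hE₀ hκ hC₉ hδ₀ hMg (B12TreeDecay.K₀_pos _ _).le F a₀ ε₂₉ γ₀ α₀ α₁ hα₀ hα₁ Mc
    (fun k n => recordRNat F Mc k (recordK₀ F Mc k + n)) (fun k n => recordR F Mc k (recordK₀ F Mc k + n) / 2 - 2 * (Mc : ℝ)) (1 / 16)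
    (by norm_num) (by norm_num) ιC h8 hsw h9 (rowG0 F Mc) (rowG1_at_recordChoice F hMc hMgMc hc₁) (rowG2_at_recordChoice F hMc hMgMc hc₁)
    (fun k n => le_rfl) (fun k z => eventually_window_recordRNat hMc k z) (fun k n => rateRows_recordW hMc k n) hleaf

/-! ## §10e  Composition with ★★★ PTB-1 in the (Q-ord)-correct shape: (Tok-cmpU-cap) discharges D9; no leaf constant precedes `δ₀` -/

/-- ★★★ **(E-lu-box) FROM (Tok-cmpU-cap) + ⁸'s MOULD ON THE BOX + THE CHART ROWS AGAINST THE TRANSVERSE TABLE** — §10d ∘ ★★★ PTB-1 ✓`PortU8.portPieceLocalityU8_LocUniv_of_cmp` at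
`α₂ := min ¼ (min α₁ (α₀∕36))`: the D9 row is DISCHARGED (constants `C₉, δ₀` produced by PTB-1's package, hence existential) and — ◆ CRIT-1 g36's rider (Q-ord), fix (f2) — the leaves
and the geometry are theorems INSIDE, so nothing is committed before `δ₀` is revealed: `(Tok-cmpU-cap) → ∀ ιC, D1-box → swap → chart rows → ∃ C₉ δ₀, 0 ≤ C₉ ∧ 0 < δ₀ ∧ (E-lu-box)(A(C₉, δ₀), δ₁(δ₀)∕16)`.
(Tok-cmpU-cap) is the tree name ✓`K0AxJoinT.TokCmpUCap F Mc a₀` (= PTB-1's `hcmp` verbatim).  What stays displayed: (Tok-cmpU-cap), D1 on the box, the swap row and the `C²`∕zero∕link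
rows of the ONE chart `ιC` against `recordGkLocWξ … univ` (jointly (ra-1)(ra-3)(ra-4) + `DressLink` ⟸ (C-orb) — OPEN), the guards.  CONDITIONAL; nothing of Bałaban asserted; K0ᴬ 27238 OPEN;
the Yang–Mills mass gap is NOT proved.
[cite: Balaban1987RG1, Thm 1 p.259, Thm 3 p.264, (1.7) p.261, (1.18)–(1.22) pp.263–264, (4.4)–(4.5) pp.281–282, (4.35)–(4.37) pp.290–291, (5.10) p.293; Balaban1985Variational, Prop. 9 p.309, (190) p.308; Balaban1984PropagatorsII, (2.35) p.228, (2.130) p.246, (2.148)-(2.150) p.249] -/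
theorem twoVolExpBox_LocUniv_of_cmp_geom {E₀ κ Mg c₁ : ℝ}
    (hE₀ : 0 ≤ E₀) (hκ : 0 < κ) (hκ₀ : 4 * B12TreeDecay.kappa₀ (4 * 2 ^ 4) (2 * 4) ≤ κ) (hc₁ : 0 ≤ c₁) :
    ∀ (F : T4Family) (a₀ ε₂₉ γ₀ α₀ α₁ : ℝ), 0 < ε₂₉ → 0 < α₀ → 0 < α₁ → ∀ Mc : ℕ, McGuard F Mc → (Mc : ℝ) ≤ Mg →
      TokCmpUCap F Mc a₀ →
      letI θ := thetaFill F a₀ ε₂₉; letI := θ.instVβ₁; letI := θ.instVβ₂; letI := θ.instιβ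
      ∀ ιC : (k n : ℕ) → recordW F a₀ ε₂₉ k (recordK₀ F Mc k + n) → (Fin (recordChartDimJ F (recordK₀ F Mc k + n)) → ℂ),
      (∀ (k : ℕ) (v : Fin (k + 1) → ℝ), v ∈ FlowStep.Box γ₀ k →
        B12FormatPlus.FormatPlusG (fun n => recordDomSys F Mc k (recordK₀ F Mc k + n)) (fun n => recordBondCount F (recordK₀ F Mc k + n))
          (fun n => recordAct F (recordK₀ F Mc k + n)) (fun n => recordUc F Mc k α₀ α₁ (recordK₀ F Mc k + n))
          (fun n => recordCoords F Mc k (recordK₀ F Mc k + n)) (fun n => recordChartDimJ F (recordK₀ F Mc k + n))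
          (fun n => recordChartJ F Mc k (recordK₀ F Mc k + n)) (fun n => recordΦfAx F a₀ ε₂₉ k v (recordK₀ F Mc k + n))
          (fun n => recordEmbJ F θ k (recordK₀ F Mc k + n)) (fun n => recordWrapCtr F Mc k (recordK₀ F Mc k + n))
          (fun n => recordDomEmbCtr F Mc k (recordK₀ F Mc k + n)) (fun n _ => recordCoordProjCtr F (recordK₀ F Mc k + n)) E₀ κ) →
      (∀ (k n : ℕ), ∀ᶠ B in 𝓝 (0 : recordW F a₀ ε₂₉ k (recordK₀ F Mc k + n)), ∀ X : (recordDomSys F Mc k (recordK₀ F Mc k + n)).Dom,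
          ∃ g : recordGaugeGrp F (recordK₀ F Mc k + n), ∀ i ∈ recordCoords F Mc k (recordK₀ F Mc k + n) X,
            recordChartJ F Mc k (recordK₀ F Mc k + n) X (ιC k n B) i =
              recordAct F (recordK₀ F Mc k + n) g (recordChartJ F Mc k (recordK₀ F Mc k + n) X (recordEmbJ F θ k (recordK₀ F Mc k + n) B)) i) →
      (∀ k : ℕ, (∀ n : ℕ, ContDiffAt ℝ 2 (ιC k n) 0 ∧ ιC k n 0 = 0) ∧
          ∀ (n : ℕ) (a : θ.ιβ) (l : RespLabel F k (recordK₀ F Mc k + n)),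
            recordGkLocWξ F θ k (recordK₀ F Mc k + n) Finset.univ a l = fun i => fderiv ℝ (ιC k n) 0 (Pi.single l.1 (Pi.single l.2 (θ.bV a))) i) →
      ∃ C₉ δ₀ : ℝ, 0 ≤ C₉ ∧ 0 < δ₀ ∧
        RecordPvolTwoVolExpLocUnifOnBoxAx F a₀ ε₂₉ γ₀
          (48 * E₀ * C₉ ^ 2 * B12TreeDecay.K₀ (4 * 2 ^ 4) (2 * 4) * (2 * (1 - Real.exp (-(δ₀ / 4 * (Mc : ℝ))))⁻¹) ^ 4 +
            32 * E₀ * C₉ ^ 2 * Real.exp (B12Decay510.delta1 δ₀ κ Mg * Mg * c₁) * B12TreeDecay.K₀ (4 * 2 ^ 4) (2 * 4) *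
              (2 * (1 - Real.exp (-(δ₀ / 4 * (Mc : ℝ))))⁻¹) ^ 4)
          (B12Decay510.delta1 δ₀ κ Mg * (1 / 16)) := by
  intro F a₀ ε₂₉ γ₀ α₀ α₁ hε hα₀ hα₁ Mc hMc hMgMc hcmp ιC h8 hsw h9
  have hα₂ : 0 < min (1 / 4 : ℝ) (min α₁ (α₀ / 36)) := lt_min (by norm_num) (lt_min hα₁ (by positivity))
  obtain ⟨C₉, δ₀, hC₉, hδ₀, hpk⟩ := PortU8.portPieceLocalityU8_LocUniv_of_cmp F Mc a₀ hMc hcmp (min (1 / 4 : ℝ) (min α₁ (α₀ / 36))) hα₂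
  exact ⟨C₉, δ₀, hC₉, hδ₀, recordPvolTwoVolExpLocUnifOnBoxAx_of_rows_box_LocUniv_geom hE₀ hκ hκ₀ hC₉ hδ₀ hc₁ F a₀ ε₂₉ γ₀ α₀ α₁ hα₀ hα₁ Mc hMc hMgMc ιC h8 hsw
    fun k => ⟨fun a => (hpk k ε₂₉ hε).1 a, (h9 k).1, (h9 k).2⟩⟩

/-! ## §10f  The cofinal-radii K0ᴬ door over the road of record's displayed rows -/

/-- ★ **THE COFINAL-RADII K0ᴬ DOOR OVER THE ROAD OF RECORD'S DISPLAYED ROWS (|β| rows by (V-absmom-box))**: if for every continuum family and cofinally small radii `a₀ ≤ a` there are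
`γ₀ ∈ ]0, ½]`, `ε₂₉ > 0`, a moment constant `M`, format constants `E₀ ≥ 0`, `κ ≥ 4·κ₀(64, 8)` (`κ > 0`), mask letters `Mg ≥ Mc`, `c₁ ≥ 0`, chart radii `α₀, α₁ > 0` and an admissible
cube letter `Mc` (`McGuard`) such that (V-absmom-box) `RecordPvolAbsMomentOnBoxAx F a₀ ε₂₉ γ₀ M` ∧ (Tok-cmpU-cap) ∧ [∃ ONE chart `ιC`: ⁸'s mould D1 AT EVERY BOX HISTORY ∧ the swap row ∧
the `C²`∕zero∕link rows against `recordGkLocWξ … univ`] hold, THEN K0ᴬ `Record13SepCoPHInhabitedAx` holds BY NAME — §10e gives (E-lu-box), then №7's ★★★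
✓`record13SepCoPHInhabitedAx_of_twoVolExpBox_pvolAbsMomentBox_cofinalRadii` ((E-lu-box) ⟹ (L-lim-box) ✓p817732 :258, Fatou through the windows ✓MB :274).  CONDITIONAL door: every
conjunct of `H` is OPEN content (D1 = W1 ⟨27930⟩'s consequent on the box; the chart rows = (ra-1)(ra-3)(ra-4) + `DressLink`; (Tok-cmpU-cap); (V-absmom-box)); K0ᴬ 27238 OPEN; NODE O 0∕1;
the Yang–Mills mass gap is NOT proved.
[cite: Balaban1987RG1, Thm 1 p.259, Thm 3 p.264, (0.20) p.256, (1.7) p.261, (1.18)–(1.22) pp.263–264, (4.35)–(4.37) pp.290–291, (5.42) p.297; Balaban1985Variational, Prop. 9 p.309, (190) p.308; Balaban1984PropagatorsII, (2.130) p.246] -/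
theorem record13SepCoPHInhabitedAx_of_cmp_chartRowsBox_pvolAbsMomentBox_cofinalRadii
    (H : ∀ F : T4Family, ∀ a : ℝ, 0 < a → ∃ a₀ : ℝ, 0 < a₀ ∧ a₀ ≤ a ∧ ∃ (γ₀ ε₂₉ M E₀ κ Mg c₁ α₀ α₁ : ℝ) (Mc : ℕ),
      0 < γ₀ ∧ γ₀ ≤ 1 / 2 ∧ 0 < ε₂₉ ∧ 0 ≤ E₀ ∧ 0 < κ ∧ 4 * B12TreeDecay.kappa₀ (4 * 2 ^ 4) (2 * 4) ≤ κ ∧ 0 ≤ c₁ ∧ 0 < α₀ ∧ 0 < α₁ ∧ McGuard F Mc ∧ (Mc : ℝ) ≤ Mg ∧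
      RecordPvolAbsMomentOnBoxAx F a₀ ε₂₉ γ₀ M ∧
      TokCmpUCap F Mc a₀ ∧
      (letI θ := thetaFill F a₀ ε₂₉; letI := θ.instVβ₁; letI := θ.instVβ₂; letI := θ.instιβ;
        ∃ ιC : (k n : ℕ) → recordW F a₀ ε₂₉ k (recordK₀ F Mc k + n) → (Fin (recordChartDimJ F (recordK₀ F Mc k + n)) → ℂ),
        (∀ (k : ℕ) (v : Fin (k + 1) → ℝ), v ∈ FlowStep.Box γ₀ k →
          B12FormatPlus.FormatPlusG (fun n => recordDomSys F Mc k (recordK₀ F Mc k + n)) (fun n => recordBondCount F (recordK₀ F Mc k + n))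
            (fun n => recordAct F (recordK₀ F Mc k + n)) (fun n => recordUc F Mc k α₀ α₁ (recordK₀ F Mc k + n))
            (fun n => recordCoords F Mc k (recordK₀ F Mc k + n)) (fun n => recordChartDimJ F (recordK₀ F Mc k + n))
            (fun n => recordChartJ F Mc k (recordK₀ F Mc k + n)) (fun n => recordΦfAx F a₀ ε₂₉ k v (recordK₀ F Mc k + n))
            (fun n => recordEmbJ F θ k (recordK₀ F Mc k + n)) (fun n => recordWrapCtr F Mc k (recordK₀ F Mc k + n))
            (fun n => recordDomEmbCtr F Mc k (recordK₀ F Mc k + n)) (fun n _ => recordCoordProjCtr F (recordK₀ F Mc k + n)) E₀ κ) ∧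
        (∀ (k n : ℕ), ∀ᶠ B in 𝓝 (0 : recordW F a₀ ε₂₉ k (recordK₀ F Mc k + n)), ∀ X : (recordDomSys F Mc k (recordK₀ F Mc k + n)).Dom,
            ∃ g : recordGaugeGrp F (recordK₀ F Mc k + n), ∀ i ∈ recordCoords F Mc k (recordK₀ F Mc k + n) X,
              recordChartJ F Mc k (recordK₀ F Mc k + n) X (ιC k n B) i =
                recordAct F (recordK₀ F Mc k + n) g (recordChartJ F Mc k (recordK₀ F Mc k + n) X (recordEmbJ F θ k (recordK₀ F Mc k + n) B)) i) ∧
        (∀ k : ℕ, (∀ n : ℕ, ContDiffAt ℝ 2 (ιC k n) 0 ∧ ιC k n 0 = 0) ∧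
            ∀ (n : ℕ) (a : θ.ιβ) (l : RespLabel F k (recordK₀ F Mc k + n)),
              recordGkLocWξ F θ k (recordK₀ F Mc k + n) Finset.univ a l = fun i => fderiv ℝ (ιC k n) 0 (Pi.single l.1 (Pi.single l.2 (θ.bV a))) i))) :
    Summit.QuantumFields.YangMills.Theses.BalabanUVNodes.Record13SepCoPHInhabitedAx := by
  refine record13SepCoPHInhabitedAx_of_twoVolExpBox_pvolAbsMomentBox_cofinalRadii fun F a ha => ?_
  obtain ⟨a₀, ha₀, hle, γ₀, ε₂₉, M, E₀, κ, Mg, c₁, α₀, α₁, Mc, hγ₀, hγh, hε, hE₀, hκ, hκ₀, hc₁, hα₀, hα₁, hMc, hMgMc, hV, hcmp, ιC, h8, hsw, h9⟩ := H F a ha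
  obtain ⟨C₉, δ₀, -, -, hE⟩ := twoVolExpBox_LocUniv_of_cmp_geom hE₀ hκ hκ₀ hc₁ F a₀ ε₂₉ γ₀ α₀ α₁ hε hα₀ hα₁ Mc hMc hMgMc hcmp ιC h8 hsw h9
  exact ⟨a₀, ha₀, hle, γ₀, ε₂₉, _, _, M, hγ₀, hγh, hε, hE, hV⟩

-- standard axioms only (the ★★★ theorems and the door)
#print axioms recordTwoVol_of_rows_G_window
#print axioms recordPvolTwoVolExpLocUnifOnBoxAx_of_rows_box_G
#print axioms recordPvolTwoVolExpLocUnifOnBoxAx_of_rows_box_LocUniv_geom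
#print axioms twoVolExpBox_LocUniv_of_cmp_geom
#print axioms record13SepCoPHInhabitedAx_of_cmp_chartRowsBox_pvolAbsMomentBox_cofinalRadii

end Summit.QuantumFields.YangMills.Theorems.K0AxMomentRoad

end
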